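/-
Copyright (c) 2026. All rights reserved.
Released under Apache 2.0 license as described in the file LICENSE.
Authors: abc-iut cell, prover seat abc-iut-L4-t11 (gen 15; cell row «T10-5 IOTAOVER@SUM», sequel of «T10-4», L4-lead m191 (2)), over
abc-iut-w6-d025's sum of log-Frobenius settings (twinned over `⋉`: `Ltimes/LogFrobeniusSettingSum.lean`) and abc-iut-L4-t3's
add-on `IotaOver` (`Ltimes/LogFrobeniusIotaOver.lean`); everything consumed BY NAME.
-/
import Literature.AnabelianGeometry.AbsoluteAnabelian.Ltimes.LogFrobeniusSettingSum
import Literature.AnabelianGeometry.AbsoluteAnabelian.Ltimes.LogFrobeniusIotaOver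
import HarnessLib

/-!
# [AbsTopIII] Def 5.4 (iv)/(vii): the add-on «`ι⊞_{v,ε}` lies over `Th•[Z]`» (`IotaOver`) is inherited by the SUM of two settings

S. Mochizuki, *Topics in absolute anabelian geometry III: global reconstruction algorithms*, J. Math. Sci. Univ. Tokyo 22 (2015)
939–1156 [MochizukiAbsTopIII2015]; manuscript `paper:url-5493eb38cbb7`: Def 5.4 (iv) p. 127 (the local functors "lie over `Th•[Z]`"),
Def 5.4 (vii) p. 128 (`ι⊞_{v,ε}`), Cor 5.10 (iv) p. 147 l. 29 (one picture over all of `V(F_mod)`).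

WHY THIS FILE (cell row «T10-5», sequel of «T10-4 CONTACT-OBS@⋉-CARRIERS»).  At abc-iut-L4-t8's two-sided `⋉`-carrier
`genuineTwoSidedSumLtimes` (the DELTA #4 setting of record) the observable clauses of Cor 5.10 (iv) take abc-iut-L4-t3's add-on
`IotaOver` of the SUM as an input.  abc-iut-w6-d025's sum (`LogFrobeniusSettingLtimes.sum`) carries, at a place of the first index set,
`ι⊞₁ × (Λ₂ ⟶ 𝟭)` — the other factor's global object rides along through `twistToId` (the identity at a pre-log source, `logIsoId`
at the post-log source) — while the structure isomorphisms "lie over `Th•[Z]`" of the sum are the factorwise products with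
`logOver` at the post-log source.  Hence `IotaOver` of the sum follows from `IotaOver` of the factors TOGETHER WITH the (evident,
but not recorded in the interface) compatibility of each factor's `logIsoId : log ≅ 𝟭` with its `logOver : log ⋙ proj ≅ proj`:
* the hypothesis «`logIsoId` lies over `logOver`» — `proj (logIsoId_X) = logOver_X` for every global object `X` — is taken as an
  explicit binder (no new named predicate; it holds by `rfl`/`map_id` at the cell's genuine carriers, where `log`, `logIsoId`,
  `logOver` are the identity / built from one isomorphism);
* ★ `iotaOver_sum` — `IotaOver Lt₁ → IotaOver Lt₂ → (logIsoId₁ over logOver₁) → (logIsoId₂ over logOver₂) → IotaOver (Lt₁.sum Lt₂)`.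
MODEL-LEVEL bookkeeping over OUR successor typing; refereed pre-IUT material; nothing here bears on [IUTchIII] Cor. 3.12; no side
taken; typed ≠ proved.
-/

set_option autoImplicit false

universe u

open CategoryTheory

namespace Literature.AnabelianGeometry.AbsoluteAnabelian

namespace LogFrobeniusSettingLtimes

section TwistToId

variable {Vmod : Type u} {isArc : Vmod → Bool} (Lt : LogFrobeniusSettingLtimes Vmod isArc)

/-- componentwise form of `twistToId` over `Th•[Z]`: the identity at a pre-log source, `logOver` at the post-log source (under
«`logIsoId` lies over `logOver`»). [cite: MochizukiAbsTopIII2015, Def 5.4 (vii) p. 128] -/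
theorem proj_map_twistToId_app (hl : ∀ X : Lt.X, Lt.proj.map (Lt.logIsoId.hom.app X) = Lt.logOver.hom.app X) :
    ∀ (c : Bool) (X : Lt.X), Lt.proj.map ((Lt.twistToId c).app X) = (Lt.twistOver c).hom.app X
  | false, X => by simp [twistToId, twistOver]
  | true, X => by simpa [twistToId, twistOver] using hl X

end TwistToId

section ProdHelpers

variable {A : Type*} [Category A] {B : Type*} [Category B] {C : Type*} [Category C] {D : Type*} [Category D]

/-- componentwise bookkeeping in a product category: first component of `eqToHom ≫ (α × β)_X`.
[cite: MochizukiAbsTopIII2015, Def 5.4 (vii) p. 128] -/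
theorem fst_eqToHom_comp_prod_app {F G : A ⥤ B} {H K : C ⥤ D} (α : F ⟶ G) (β : H ⟶ K) (X : A × C)
    {P : B × D} (h : P = (F.prod H).obj X) :
    (eqToHom h ≫ (NatTrans.prod α β).app X).1 = eqToHom (congrArg Prod.fst h) ≫ α.app X.1 := by
  subst h
  simp

/-- componentwise bookkeeping in a product category: second component of `eqToHom ≫ (α × β)_X`.
[cite: MochizukiAbsTopIII2015, Def 5.4 (vii) p. 128] -/
theorem snd_eqToHom_comp_prod_app {F G : A ⥤ B} {H K : C ⥤ D} (α : F ⟶ G) (β : H ⟶ K) (X : A × C)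
    {P : B × D} (h : P = (F.prod H).obj X) :
    (eqToHom h ≫ (NatTrans.prod α β).app X).2 = eqToHom (congrArg Prod.snd h) ≫ β.app X.2 := by
  subst h
  simp

end ProdHelpers

section Sum

variable {V₁ V₂ : Type u} {isArc₁ : V₁ → Bool} {isArc₂ : V₂ → Bool}
  {Lt₁ : LogFrobeniusSettingLtimes V₁ isArc₁} {Lt₂ : LogFrobeniusSettingLtimes V₂ isArc₂}

/-- the `IotaOver` equation of the sum at a place of the FIRST index set, componentwise, for a free twist parameter `c` and
an arbitrary `α` in the rôle of `ι⊞₁` (so that the case analysis on `c` is type-correct). [cite: MochizukiAbsTopIII2015, Def 5.4 (vii) p. 128] -/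
theorem iotaOver_sum_aux_inl (c : Bool) (v : V₁) (ν₁ ν₂ : LogVertex (isArc₁ v))
    (α : frobeniusTwist Lt₁.log c ⋙ Lt₁.lam v ν₁ ⟶ Lt₁.lam v ν₂) (x₁ : Lt₁.X) (x₂ : Lt₂.X)
    (e₁ : (Lt₁.toE v).map ((Lt₁.forget v).map (α.app x₁)) =
      ((Lt₁.lamOver v ν₁).hom.app ((frobeniusTwist Lt₁.log c).obj x₁) ≫ (Lt₁.twistOver c).hom.app x₁) ≫
        (Lt₁.lamOver v ν₂).inv.app x₁)
    (e₂ : Lt₂.proj.map ((Lt₂.twistToId c).app x₂) = (Lt₂.twistOver c).hom.app x₂) :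
    ((Lt₁.sum Lt₂).toE (.inl v)).map (((Lt₁.sum Lt₂).forget (.inl v)).map
        ((eqToHom (twist_comp_sumLam_inl Lt₁ Lt₂ c v ν₁) ≫ NatTrans.prod α (Lt₂.twistToId c)).app (x₁, x₂))) =
      (((Lt₁.sum Lt₂).lamOver (.inl v) ν₁).hom.app ((frobeniusTwist (Lt₁.sum Lt₂).log c).obj (x₁, x₂)) ≫
          ((Lt₁.sum Lt₂).twistOver c).hom.app (x₁, x₂)) ≫
        ((Lt₁.sum Lt₂).lamOver (.inl v) ν₂).inv.app (x₁, x₂) := by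
  cases c
  · -- pre-log source: `Λ = 𝟭`, the carried factor rides along the identity
    dsimp only [LogFrobeniusSettingLtimes.sum, sumToE, sumForget, sumLam, sumLamOver, sumNplusCat, sumNCat, Cat.of,
      Bundled.of, twistOver, twistToId] at e₁ e₂ ⊢
    erw [NatTrans.comp_app, eqToHom_app, Category.assoc]
    apply CategoryTheory.Prod.hom_ext <;>
      simp [NatTrans.prod_app_fst, NatTrans.prod_app_snd, NatIso.prod_hom, NatIso.prod_inv, Iso.trans_hom, Iso.trans_inv,
        Functor.prod_map]
    · erw [fst_eqToHom_comp_prod_app, eqToHom_refl, Category.id_comp]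
      simp only [frobeniusTwist_false, Functor.id_obj, Functor.leftUnitor_hom_app, Category.comp_id] at e₁
      exact e₁
    · erw [snd_eqToHom_comp_prod_app, eqToHom_refl, Category.id_comp, Category.id_comp, NatTrans.id_app,
        CategoryTheory.Functor.map_id]
      rfl
  · -- post-log source: `Λ = log`, the carried factor rides along `logIsoId`, read over `Th•[Z]` through `logOver`
    dsimp only [LogFrobeniusSettingLtimes.sum, sumToE, sumForget, sumLam, sumLamOver, sumNplusCat, sumNCat, Cat.of,
      Bundled.of, twistOver, twistToId] at e₁ e₂ ⊢
    erw [NatTrans.comp_app, eqToHom_app, Category.assoc]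
    apply CategoryTheory.Prod.hom_ext <;>
      simp [NatTrans.prod_app_fst, NatTrans.prod_app_snd, NatIso.prod_hom, NatIso.prod_inv, Iso.trans_hom, Iso.trans_inv,
        Functor.prod_map]
    · erw [fst_eqToHom_comp_prod_app, eqToHom_refl, Category.id_comp]
      simp only [frobeniusTwist_true, Category.assoc] at e₁
      exact e₁
    · erw [snd_eqToHom_comp_prod_app, eqToHom_refl, Category.id_comp]
      erw [Category.id_comp, Category.comp_id]
      exact e₂

/-- the same at a place of the SECOND index set. [cite: MochizukiAbsTopIII2015, Def 5.4 (vii) p. 128] -/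
theorem iotaOver_sum_aux_inr (c : Bool) (v : V₂) (ν₁ ν₂ : LogVertex (isArc₂ v))
    (α : frobeniusTwist Lt₂.log c ⋙ Lt₂.lam v ν₁ ⟶ Lt₂.lam v ν₂) (x₁ : Lt₁.X) (x₂ : Lt₂.X)
    (e₁ : Lt₁.proj.map ((Lt₁.twistToId c).app x₁) = (Lt₁.twistOver c).hom.app x₁)
    (e₂ : (Lt₂.toE v).map ((Lt₂.forget v).map (α.app x₂)) =
      ((Lt₂.lamOver v ν₁).hom.app ((frobeniusTwist Lt₂.log c).obj x₂) ≫ (Lt₂.twistOver c).hom.app x₂) ≫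
        (Lt₂.lamOver v ν₂).inv.app x₂) :
    ((Lt₁.sum Lt₂).toE (.inr v)).map (((Lt₁.sum Lt₂).forget (.inr v)).map
        ((eqToHom (twist_comp_sumLam_inr Lt₁ Lt₂ c v ν₁) ≫ NatTrans.prod (Lt₁.twistToId c) α).app (x₁, x₂))) =
      (((Lt₁.sum Lt₂).lamOver (.inr v) ν₁).hom.app ((frobeniusTwist (Lt₁.sum Lt₂).log c).obj (x₁, x₂)) ≫
          ((Lt₁.sum Lt₂).twistOver c).hom.app (x₁, x₂)) ≫
        ((Lt₁.sum Lt₂).lamOver (.inr v) ν₂).inv.app (x₁, x₂) := by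
  cases c
  · -- pre-log source
    dsimp only [LogFrobeniusSettingLtimes.sum, sumToE, sumForget, sumLam, sumLamOver, sumNplusCat, sumNCat, Cat.of,
      Bundled.of, twistOver, twistToId] at e₁ e₂ ⊢
    erw [NatTrans.comp_app, eqToHom_app, Category.assoc]
    apply CategoryTheory.Prod.hom_ext <;>
      simp [NatTrans.prod_app_fst, NatTrans.prod_app_snd, NatIso.prod_hom, NatIso.prod_inv, Iso.trans_hom, Iso.trans_inv,
        Functor.prod_map]
    · erw [fst_eqToHom_comp_prod_app, eqToHom_refl, Category.id_comp, Category.id_comp, NatTrans.id_app,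
        CategoryTheory.Functor.map_id]
      rfl
    · erw [snd_eqToHom_comp_prod_app, eqToHom_refl, Category.id_comp]
      simp only [frobeniusTwist_false, Functor.id_obj, Functor.leftUnitor_hom_app, Category.comp_id] at e₂
      exact e₂
  · -- post-log source
    dsimp only [LogFrobeniusSettingLtimes.sum, sumToE, sumForget, sumLam, sumLamOver, sumNplusCat, sumNCat, Cat.of,
      Bundled.of, twistOver, twistToId] at e₁ e₂ ⊢
    erw [NatTrans.comp_app, eqToHom_app, Category.assoc]
    apply CategoryTheory.Prod.hom_ext <;>
      simp [NatTrans.prod_app_fst, NatTrans.prod_app_snd, NatIso.prod_hom, NatIso.prod_inv, Iso.trans_hom, Iso.trans_inv,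
        Functor.prod_map]
    · erw [fst_eqToHom_comp_prod_app, eqToHom_refl, Category.id_comp]
      erw [Category.id_comp, Category.comp_id]
      exact e₁
    · erw [snd_eqToHom_comp_prod_app, eqToHom_refl, Category.id_comp]
      simp only [frobeniusTwist_true, Category.assoc] at e₂
      exact e₂

/-- ★ **`IotaOver` is inherited by the sum**: if the `ι⊞` of both factors lie over `Th•[Z]` and each factor's `logIsoId` lies over its
`logOver`, then the `ι⊞` of abc-iut-w6-d025's sum lie over `Th•[Z] = ℰ₁ × ℰ₂` — at a place of the first index set the first component is
the factor's own equation and the second is `proj₂ (twistToId₂) = twistOver₂` (symmetrically at a place of the second index set).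
[cite: MochizukiAbsTopIII2015, Def 5.4 (vii) p. 128] -/
theorem iotaOver_sum (h₁ : Lt₁.IotaOver) (h₂ : Lt₂.IotaOver)
    (hl₁ : ∀ X : Lt₁.X, Lt₁.proj.map (Lt₁.logIsoId.hom.app X) = Lt₁.logOver.hom.app X)
    (hl₂ : ∀ X : Lt₂.X, Lt₂.proj.map (Lt₂.logIsoId.hom.app X) = Lt₂.logOver.hom.app X) :
    (Lt₁.sum Lt₂).IotaOver := by
  apply IotaOver.of_app
  rintro (v | v) ν₁ ν₂ ε ⟨x₁, x₂⟩
  · have e₁ := h₁.app v ε x₁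
    dsimp only [LogFrobeniusSettingLtimes.lamTwistOver] at e₁ ⊢
    rw [sum_iota_inl]
    simp only [Iso.trans_hom, NatTrans.comp_app, Functor.associator_hom_app, Functor.isoWhiskerLeft_hom,
      Functor.whiskerLeft_app] at e₁ ⊢
    erw [Category.id_comp] at e₁
    erw [Category.id_comp]
    exact iotaOver_sum_aux_inl ν₁.isPostLog v ν₁ ν₂ (Lt₁.iota v ε) x₁ x₂ e₁
      (Lt₂.proj_map_twistToId_app hl₂ ν₁.isPostLog x₂)
  · have e₂ := h₂.app v ε x₂
    dsimp only [LogFrobeniusSettingLtimes.lamTwistOver] at e₂ ⊢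
    rw [sum_iota_inr]
    simp only [Iso.trans_hom, NatTrans.comp_app, Functor.associator_hom_app, Functor.isoWhiskerLeft_hom,
      Functor.whiskerLeft_app] at e₂ ⊢
    erw [Category.id_comp] at e₂
    erw [Category.id_comp]
    exact iotaOver_sum_aux_inr ν₁.isPostLog v ν₁ ν₂ (Lt₂.iota v ε) x₁ x₂
      (Lt₁.proj_map_twistToId_app hl₁ ν₁.isPostLog x₁) e₂

end Sum

end LogFrobeniusSettingLtimes

end Literature.AnabelianGeometry.AbsoluteAnabelian
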